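import Summits.QuantumFields.QCD.Theses.PauliWegnerSea
import Literature.Barriers.QuantumFields.WilsonDeterminantSign
import Literature.MathematicalPhysics.QuantumLattice.OverlapLocality

/-!
# Disproof workbench for `FibreCofactorDomination` (K1, stmt-QuantumFields-11510)

Standing-adversary file (refuter cdisprove seat).  Prose lives in docstrings; every `theorem` here is
checked (`lean check` rc 0) unless it sits in the `NearMisses` section (sorries allowed there only).

## Findings (index)

* `VolumeWeighted`, `fibreCofactorDomination_iff_volumeWeighted` (both directions proved:
  `volumeWeighted_of_fibreCofactorDomination` via `n_w ≤ 12·L⁴` = `countP ≤ card roots ≤ natDegree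
  charpoly = |index|`; `fibreCofactorDomination_of_volumeWeighted` via `θ₀ := 11 > |m₀+4|+4 ≥ ‖Γ₅D_W‖`,
  `roots charpoly = eigenvalues` of the Hermitian `Γ₅ D_W`, so `n_w = 12 L⁴`) — K1 is EQUIVALENT to
  the window-free, volume-weighted cofactor bound; the spectral window carries no information.  Consequence for refuters: a counterexample to the
  volume-weighted form (ratio `sup_fibre ‖adj_xy‖ / sup_fibre |det|` unbounded over backgrounds `U`
  at ONE fixed `L ≥ 4` and ONE `m₀ ∈ [-2,2]`) kills K1; the in-window count is irrelevant to a kill.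
* `SchurReduction` (docstring theorem-sketch + the 2×2-block identity used by the numerics):
  with `X = {x,y}`, `R = Xᶜ`, `D(refit W) = [[A(W), B(W)],[C(W), D_RR]]` and `D_RR` invertible,
  `det D = det D_RR · det S(W)`, `adj(D)_{XX} = det D_RR · adj S(W)`, `S(W) = A − B G C`,
  `G = (D_RR⁻¹)|ports` (a 168×168 resp. 192×192 matrix — the ONLY datum of the exterior that enters).
  Hence the crux ratio equals `sup_W ‖adj S(W)_xy‖₁ / sup_W |det S(W)|` for a 24×24 family.
* `caricature`, `caricature_det`, `caricature_adjugate_xy` — the rotating-kernel mechanism of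
  refuter g44-24 as a checked finite-matrix fact: a Schur-complement-shaped family `S(w)` with
  `det S(w) = 0` for EVERY fibre parameter `w` while the `(x,y)` adjugate entry equals `a·w ≠ 0`.
  So "sup adj_xy ≤ C · sup det" is FALSE for abstract families with the local (projector) structure of
  the two-star Schur complement: any proof of K1 must use REALISABILITY of the port Green matrix `G`
  by an actual Wilson–Dirac exterior (this is the load-bearing hypothesis; see `whyItResists`).
* §3 `Matrix.det_eq_zero_of_mapsTo_of_finrank_lt`, `Matrix.adjugate_apply_eq_zero_of_ker`
  (subspace mechanisms are harmless): every fibre-wide degeneracy forced by a FIXED subspace (zero modes of `D(U)` vanishing on `X`, Dirichlet zero modes of `D_{XᶜXᶜ}`, large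
  `dim ker D(U)` …) produces kernel vectors vanishing at `x` and `y`, hence `adj_xy = κ φ(x)(γ₅φ)(y)† = 0`
  in corank one: such backgrounds satisfy K1 trivially (`0 ≤ 0`).  A kill needs a ROTATING kernel.
* §6: ABSTRACT RIGIDITY IS FALSE — explicit `G* = G₀ + H` (colour-blind port-diagonal skeleton tuned to
  `det M_y = 0`, dressed by colour-rank-2 inter-port blocks) has `det S ≡ 0` on the whole fibre with
  corank 1 and `adj_xy ≠ 0`; so every proof must use realisability, and the realisable target is
  sharpened to (i) port-diagonal (ii) colour-blind (iii) tuned exteriors.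
* Numerics (kit, cited by job id in §4/§6): corank scan, realisable adversarial descent on `4⁴`/`6⁴`,
  realisable tangent ranks, abstract searches, k-link ladder, local codimension of `𝒵`.

-/

namespace Summit.QuantumFields.QCD.Cruxes.FibreCofactorDomination.Disproof

open scoped BigOperators Matrix Matrix.Norms.L2Operator Kronecker
open Summit.QuantumFields.QCD.Theses.PauliWegnerSea
open Literature.MathematicalPhysics.QuantumFieldTheory Literature.MathematicalPhysics.QuantumLattice
  Literature.Probability.LatticeModels

/-! ## 1. The typed statement implies the volume-weighted (window-free) statement -/

/-- The window-free, volume-weighted cofactor bound: the crux with `(1 + n_w)` replaced by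
`(1 + 12 L⁴)` and no `θ₀`.  K1 as typed implies it (`volumeWeighted_of_fibreCofactorDomination`),
so refuting THIS refutes K1. [folklore] -/
def VolumeWeighted : Prop :=
  ∀ m₀ : ℝ, -2 ≤ m₀ → m₀ ≤ 2 → ∃ C₀ : ℝ, 0 < C₀ ∧ ∀ (L : ℕ) [NeZero L], 4 ≤ L →
    ∀ (U : GaugeConfig 4 L (Matrix.specialUnitaryGroup (Fin 3) ℂ)) (x y : TorusSite 4 L), x ≠ y →
    let star : Edge 4 L → Prop := fun e => e.1 = x ∨ Site.shift e.1 e.2 = x ∨ e.1 = y ∨ Site.shift e.1 e.2 = y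
    let refit : GaugeConfig 4 L (Matrix.specialUnitaryGroup (Fin 3) ℂ) →
        GaugeConfig 4 L (Matrix.specialUnitaryGroup (Fin 3) ℂ) := fun W e => if star e then W e else U e
    let D : GaugeConfig 4 L (Matrix.specialUnitaryGroup (Fin 3) ℂ) →
        Matrix (TorusSite 4 L × Fin 3 × Fin 4) (TorusSite 4 L × Fin 3 × Fin 4) ℂ :=
      fun V => wilsonDirac (fundamentalRep (Fin 3)) V m₀ 1
    ∀ W : GaugeConfig 4 L (Matrix.specialUnitaryGroup (Fin 3) ℂ),
      ∃ W' : GaugeConfig 4 L (Matrix.specialUnitaryGroup (Fin 3) ℂ),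
        (∑ a : Fin 3, ∑ i : Fin 4, ∑ b : Fin 3, ∑ j : Fin 4,
            ‖(D (refit W)).adjugate (x, a, i) (y, b, j)‖) ≤
          C₀ * (1 + 12 * (L : ℝ) ^ 4) * ‖(D (refit W')).det‖

/-- The in-window count never exceeds the matrix size: `countP _ (charpoly M).roots ≤ 12 L⁴` for any
`12L⁴ × 12L⁴` matrix on the quark index type. [folklore] -/
theorem countP_roots_charpoly_le {L : ℕ} [NeZero L] (p : ℂ → Prop) [DecidablePred p]
    (M : Matrix (TorusSite 4 L × Fin 3 × Fin 4) (TorusSite 4 L × Fin 3 × Fin 4) ℂ) :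
    ((Multiset.countP p M.charpoly.roots : ℕ) : ℝ) ≤ 12 * (L : ℝ) ^ 4 := by
  have h1 : Multiset.countP p M.charpoly.roots ≤ Multiset.card M.charpoly.roots :=
    Multiset.countP_le_card _ _
  have h2 : Multiset.card M.charpoly.roots ≤ M.charpoly.natDegree := Polynomial.card_roots' _
  have h3 : M.charpoly.natDegree = Fintype.card (TorusSite 4 L × Fin 3 × Fin 4) :=
    Matrix.charpoly_natDegree_eq_dim M
  have h4 : Fintype.card (TorusSite 4 L × Fin 3 × Fin 4) = L ^ 4 * 12 := by
    simp [Fintype.card_prod, Fintype.card_fin, Fintype.card_pi, ZMod.card, Finset.prod_const]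
  have : (Multiset.countP p M.charpoly.roots : ℕ) ≤ L ^ 4 * 12 := by omega
  calc ((Multiset.countP p M.charpoly.roots : ℕ) : ℝ) ≤ ((L ^ 4 * 12 : ℕ) : ℝ) := by exact_mod_cast this
    _ = 12 * (L : ℝ) ^ 4 := by push_cast; ring

/-- **K1 ⇒ volume-weighted K1.**  Because `θ₀` is only required to be positive and `n_w ≤ 12 L⁴`,
the typed crux implies the window-free bound with the factor `(1 + 12 L⁴)`; contrapositively, any
background family breaking the volume-weighted bound at a single `(L, m₀)` refutes K1. [folklore] -/
theorem volumeWeighted_of_fibreCofactorDomination (h : FibreCofactorDomination) : VolumeWeighted := by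
  intro m₀ h1 h2
  obtain ⟨θ₀, C₀, _hθ, hC, H⟩ := h m₀ h1 h2
  refine ⟨C₀, hC, ?_⟩
  intro L _ hL U x y hxy star refit D W
  obtain ⟨W', hW'⟩ := H L hL U x y hxy W
  refine ⟨W', hW'.trans ?_⟩
  have hnw := countP_roots_charpoly_le (fun z : ℂ => |z.re| < θ₀)
    (spinorLift gammaFive * D U)
  have hdet : 0 ≤ ‖(D (refit W')).det‖ := norm_nonneg _
  gcongr

/-- Contrapositive packaging for the refutation pipeline. [folklore] -/
theorem not_fibreCofactorDomination_of_not_volumeWeighted (h : ¬ VolumeWeighted) :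
    ¬ FibreCofactorDomination := fun hK => h (volumeWeighted_of_fibreCofactorDomination hK)

/-! ### The converse: the volume-weighted form implies K1 (so the two are EQUIVALENT)

With `θ₀ := 11 > |m₀ + 4| + 4 ≥ ‖Γ₅ D_W(U)‖` every root of the characteristic polynomial of the
Hermitian `Γ₅ D_W(U)` (= every eigenvalue, real) lies in the window, so `n_w = 12 L⁴` and the typed
bound with `(θ₀, C₀) = (11, C₀)` is literally the volume-weighted bound.  Net: the spectral window of
K1 carries no information — `FibreCofactorDomination ↔ VolumeWeighted`. -/

/-- Eigenvalues of a Hermitian matrix are bounded by its ℓ² operator norm. [folklore] -/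
theorem abs_eigenvalues_le_l2_opNorm {n : Type*} [Fintype n] [DecidableEq n] {A : Matrix n n ℂ}
    (hA : A.IsHermitian) (i : n) : |hA.eigenvalues i| ≤ ‖A‖ := by
  have hv : ‖(hA.eigenvectorBasis i : EuclideanSpace ℂ n)‖ = 1 := hA.eigenvectorBasis.orthonormal.1 i
  have h1 := Matrix.l2_opNorm_mulVec A (hA.eigenvectorBasis i)
  rw [hA.mulVec_eigenvectorBasis i, hv, mul_one] at h1
  have h2 : ‖(EuclideanSpace.equiv n ℂ).symm ((hA.eigenvalues i) • ⇑(hA.eigenvectorBasis i))‖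
      = |hA.eigenvalues i| := by
    rw [RCLike.real_smul_eq_coe_smul (K := ℂ), map_smul, norm_smul]
    simp [hv]
  rw [h2] at h1
  exact h1

/-- `‖Γ₅‖ ≤ 1` in the ℓ² operator norm (`Γ₅ᴴ Γ₅ = 1`). [folklore] -/
theorem l2_opNorm_spinorLift_gammaFive_le {L N : ℕ} [NeZero L] :
    ‖(spinorLift gammaFive :
        Matrix (TorusSite 4 L × Fin N × Fin 4) (TorusSite 4 L × Fin N × Fin 4) ℂ)‖ ≤ 1 := by
  have hone : ‖(1 : Matrix (TorusSite 4 L × Fin N × Fin 4) (TorusSite 4 L × Fin N × Fin 4) ℂ)‖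
      ≤ 1 := by
    rw [Matrix.cstar_norm_def, map_one]
    exact ContinuousLinearMap.norm_id_le
  have hsq : ‖(spinorLift gammaFive : Matrix (TorusSite 4 L × Fin N × Fin 4) _ ℂ)‖ *
      ‖(spinorLift gammaFive : Matrix (TorusSite 4 L × Fin N × Fin 4) _ ℂ)‖ ≤ 1 := by
    rw [← Matrix.l2_opNorm_conjTranspose_mul_self,
      Literature.Barriers.QuantumFields.WilsonDeterminant.conjTranspose_spinorLift_gammaFive,
      spinorLift_gammaFive_mul_self]
    exact hone
  nlinarith [norm_nonneg (spinorLift gammaFive : Matrix (TorusSite 4 L × Fin N × Fin 4) _ ℂ)]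

/-- Every eigenvalue of `Γ₅ D_W(U, m₀, r = 1)` has modulus `≤ |m₀ + 4| + 4` (HJL (2.14) and
`‖Γ₅‖ ≤ 1`). [folklore] -/
theorem abs_eigenvalues_hermitianWilsonDirac_le {L : ℕ} [NeZero L]
    (U : GaugeConfig 4 L (Matrix.specialUnitaryGroup (Fin 3) ℂ)) (m₀ : ℝ)
    (i : TorusSite 4 L × Fin 3 × Fin 4) :
    |(Literature.Barriers.QuantumFields.WilsonDeterminant.isHermitian_hermitianWilsonDirac
        (fundamentalRep (Fin 3)) fundamentalRep_mem_unitaryGroup U m₀ 1).eigenvalues i| ≤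
      |m₀ + 4| + 4 := by
  refine (abs_eigenvalues_le_l2_opNorm _ i).trans ?_
  unfold Literature.Barriers.QuantumFields.WilsonDeterminant.hermitianWilsonDirac
  refine (norm_mul_le _ _).trans ?_
  have h1 := l2_opNorm_spinorLift_gammaFive_le (L := L) (N := 3)
  have h2 := l2_opNorm_wilsonDirac_le (fundamentalRep (Fin 3)) fundamentalRep_mem_unitaryGroup U m₀
  have h3 : 0 ≤ ‖wilsonDirac (fundamentalRep (Fin 3)) U m₀ 1‖ := norm_nonneg _
  nlinarith

/-- With the window `θ₀ = 11` the in-window count of K1 is the full dimension: `n_w = 12 L⁴` for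
every background `U` and every `m₀ ∈ [-2, 2]`. [folklore] -/
theorem countP_roots_eq_card {L : ℕ} [NeZero L]
    (U : GaugeConfig 4 L (Matrix.specialUnitaryGroup (Fin 3) ℂ)) {m₀ : ℝ} (h1 : -2 ≤ m₀)
    (h2 : m₀ ≤ 2) :
    ((Multiset.countP (fun z : ℂ => |z.re| < 11)
        (spinorLift gammaFive * wilsonDirac (fundamentalRep (Fin 3)) U m₀ 1).charpoly.roots : ℕ) :
          ℝ) = 12 * (L : ℝ) ^ 4 := by
  have hH := Literature.Barriers.QuantumFields.WilsonDeterminant.isHermitian_hermitianWilsonDirac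
    (fundamentalRep (Fin 3)) fundamentalRep_mem_unitaryGroup U m₀ 1
  have hroots : (spinorLift gammaFive * wilsonDirac (fundamentalRep (Fin 3)) U m₀ 1).charpoly.roots =
      Multiset.map (RCLike.ofReal ∘ hH.eigenvalues) Finset.univ.val :=
    hH.roots_charpoly_eq_eigenvalues
  have hall : ∀ i : TorusSite 4 L × Fin 3 × Fin 4,
      |((RCLike.ofReal ∘ hH.eigenvalues) i : ℂ).re| < 11 := by
    intro i
    have hb := abs_eigenvalues_hermitianWilsonDirac_le U m₀ i
    have : |m₀ + 4| + 4 ≤ 10 := by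
      rw [abs_of_nonneg (by linarith)]; linarith
    simpa using (hb.trans this).trans_lt (by norm_num)
  rw [hroots, Multiset.countP_eq_card.mpr ?_, Multiset.card_map, Finset.card_val, Finset.card_univ]
  · have h4 : Fintype.card (TorusSite 4 L × Fin 3 × Fin 4) = L ^ 4 * 12 := by
      simp [Fintype.card_prod, Fintype.card_fin, Fintype.card_pi, ZMod.card, Finset.prod_const]
    rw [h4]; push_cast; ring
  · intro z hz
    obtain ⟨i, _, rfl⟩ := Multiset.mem_map.mp hz
    exact hall i

/-- **Volume-weighted K1 ⇒ K1** (witness `θ₀ = 11`). [folklore] -/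
theorem fibreCofactorDomination_of_volumeWeighted (h : VolumeWeighted) : FibreCofactorDomination := by
  intro m₀ h1 h2
  obtain ⟨C₀, hC, H⟩ := h m₀ h1 h2
  refine ⟨11, C₀, by norm_num, hC, ?_⟩
  intro L _ hL U x y hxy star refit D nw W
  obtain ⟨W', hW'⟩ := H L hL U x y hxy W
  refine ⟨W', hW'.trans ?_⟩
  have hnw : (12 * (L : ℝ) ^ 4) = (nw : ℝ) := (countP_roots_eq_card U h1 h2).symm
  rw [hnw]

/-- **K1 is equivalent to its window-free, volume-weighted form**: the spectral window `θ₀` and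
the in-window mode count `n_w` of the typed statement carry no information (the `∃ θ₀` may always
be taken above the spectral radius).  Provers may target `VolumeWeighted`; refuters need only break
it; the planner's intended `(1 + n_w)` refinement would need `θ₀` capped or `∀ θ₀ ∃ C₀(θ₀)`.
[folklore] -/
theorem fibreCofactorDomination_iff_volumeWeighted : FibreCofactorDomination ↔ VolumeWeighted :=
  ⟨volumeWeighted_of_fibreCofactorDomination, fibreCofactorDomination_of_volumeWeighted⟩

/-! ## 2. The rotating-kernel caricature (refuter g44-24), as a checked finite-matrix fact

Two "sites" `x, y` with a 2-dimensional spin space, hop projectors `P = diag(1,0)` (x → y) and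
`Q = diag(0,1)` (y → x) with `Q P = 0` (the `r = 1` no-backtracking identity
`¼(1+γ_μ)(1-γ_μ) = 0`), a fibre parameter `w` on the link (and an independent `w'` standing for
`w⁻¹`, so that no field inverse is needed), mass term `a` at `x` and a singular effective block
`d = [[1,1],[1,1]]` at `y` (exterior self-energy tuned to a zero mode).  In the basis
`(x↑, x↓, y↑, y↓)`:  `S(a,w,w') = [[a,0,-w,0],[0,a,0,0],[0,0,1,1],[0,-w',1,1]]`. -/

/-- The 4×4 two-site caricature of the two-star Schur complement. [folklore] -/
def caricature (a w w' : ℂ) : Matrix (Fin 4) (Fin 4) ℂ :=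
  !![a, 0, -w, 0; 0, a, 0, 0; 0, 0, 1, 1; 0, -w', 1, 1]

/-- `det S(a,w,w') = 0` for EVERY fibre parameter: the determinant is blind to the link. [folklore] -/
theorem caricature_det (a w w' : ℂ) : (caricature a w w').det = 0 := by
  simp (config := {decide := true}) [caricature, Matrix.det_succ_row_zero, Fin.sum_univ_succ,
    Matrix.submatrix_apply, Fin.succAbove]

/-- … while the `(x↑, y↑)` adjugate entry is `a·w`, non-zero on the whole fibre when `a ≠ 0`:
`sup_fibre |adj_xy| / sup_fibre |det| = ∞` for this abstract family.  Any proof of K1 must therefore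
use that the port Green matrix comes from an actual Wilson–Dirac exterior. [folklore] -/
theorem caricature_adjugate_xy (a w w' : ℂ) : (caricature a w w').adjugate 0 2 = a * w := by
  rw [Matrix.adjugate_fin_succ_eq_det_submatrix]
  simp (config := {decide := true}) [caricature, Matrix.det_fin_three, Matrix.submatrix_apply,
    Fin.succAbove]
  ring

/-- The kill shape, abstractly: a family on which `det` vanishes identically but an `(x,y)` cofactor
does not cannot satisfy any bound `cofactor ≤ C · sup det`. [folklore] -/
theorem no_domination_of_det_zero {ι : Type*} (adjxy det : ι → ℝ) (hdet : ∀ i, det i = 0)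
    {i₀ : ι} (hadj : 0 < adjxy i₀) (C : ℝ) : ¬ ∀ i, ∃ i', adjxy i ≤ C * det i' := by
  intro h
  obtain ⟨i', hi'⟩ := h i₀
  rw [hdet i', mul_zero] at hi'
  exact absurd hi' (not_le.mpr hadj)

/-! ## 3. Subspace ("big kernel") mechanisms force `det ≡ 0` but are harmless for K1

Write `X = {x, y}` (24 quark indices), `Δ(W) = D(refit W) − D(U)` (supported on the rows and columns
of `X`; rank ≤ 48).  Three ways to force `det D(refit W) = 0` for EVERY `W`, all instances of
`Matrix.det_eq_zero_of_mapsTo_of_finrank_lt` below: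
* `dim ker D(U) ≥ 49` (`V = ker D(U)`, `W' = range Δ(W)`, `dim W' ≤ 48`);
* `N' := {φ ∈ ker D(U) : φ|_X = 0}` with `dim N' ≥ 25` (`D(refit W) N' ⊆ ℂ^X`, 24-dimensional) —
  e.g. the FREE field at `m₀ = −2` on `4⁴` (`dim ker = 48`, momenta `π ê_μ`) with `y − x` of constant
  parity (`(1,1,1,1)`, `2ê_μ`, …): `dim N' = 36`, forced corank ≥ 12 on the whole fibre;
* Dirichlet zero modes: `M := ker D(U)_{XᶜXᶜ}` with `dim M ≥ 25` (`D(refit W) M ⊆ ℂ^X`).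
In every one of these the forced kernel vectors VANISH ON `X`; by γ₅-hermiticity the left kernel is
`Γ₅ ×` the right kernel, so in corank one `adj = κ φ (Γ₅ φ)†` has `adj_{(x,·),(y,·)} = 0`
(`Matrix.adjugate_apply_eq_zero_of_ker` below), in corank ≥ 2 `adj = 0`: both sides of K1 vanish,
`0 ≤ 0`.  The ε-perturbative version is equally harmless: at `U* + εY` the leading adjugate
coefficient is `Φ(x)·adj(Ψ†YΦ)·Ψ(y)† = 0`, so `adj_xy = O(ε^{corank})` like `sup_fibre det`.
MORAL (for provers and for this seat): a kill needs a kernel that ROTATES with `W` and keeps weight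
on `x` and `y` — the caricature of §2 — not a large or rigid kernel. -/

/-- **Subspace mechanism.** If a square matrix maps a subspace `V` into a subspace `W` of strictly
smaller dimension then it is singular.  (Used with `V` = zero modes of the background vanishing on
the two stars' centres, `W` = the 24 coordinates at `x, y`: forces `det D(refit W) = 0` on the whole
fibre as soon as `dim V ≥ 25`.) [folklore] -/
theorem _root_.Matrix.det_eq_zero_of_mapsTo_of_finrank_lt {K : Type*} [Field K] {n : Type*}
    [Fintype n] [DecidableEq n] (A : Matrix n n K) (V W : Submodule K (n → K))
    (hVW : ∀ v ∈ V, A.mulVec v ∈ W) (hdim : Module.finrank K W < Module.finrank K V) :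
    A.det = 0 := by
  let f : V →ₗ[K] W :=
    { toFun := fun v => ⟨A.mulVec v, hVW v v.2⟩
      map_add' := by intro v w; ext; simp [Matrix.mulVec_add]
      map_smul' := by intro c v; ext; simp [Matrix.mulVec_smul] }
  have hker : LinearMap.ker f ≠ ⊥ := LinearMap.ker_ne_bot_of_finrank_lt hdim
  obtain ⟨v, hv, hv0⟩ := Submodule.exists_mem_ne_zero_of_ne_bot hker
  rw [LinearMap.mem_ker] at hv
  have hAv : A.mulVec (v : n → K) = 0 := by
    have := congrArg Subtype.val hv
    simpa [f] using this
  have hv0' : (v : n → K) ≠ 0 := fun h => hv0 (Subtype.ext h)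
  exact Matrix.exists_mulVec_eq_zero_iff.mp ⟨v, hv0', hAv⟩

/-- **Corank-one bookkeeping.** If the kernel of a singular `A` is spanned by `v` then every column
of `adj A` is a multiple of `v` (`A · adj A = det A · 1 = 0`); in particular `adj A i j = 0` at every
row `i` where `v i = 0`.  (With `v` = the forced kernel vector of a subspace mechanism, vanishing at
`x`: the whole `(x, ·)` block of the adjugate vanishes — such fibres satisfy K1 trivially.) [folklore] -/
theorem _root_.Matrix.adjugate_apply_eq_zero_of_ker {K : Type*} [Field K] {n : Type*} [Fintype n]
    [DecidableEq n] (A : Matrix n n K) (hA : A.det = 0) (v : n → K)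
    (hker : ∀ w : n → K, A.mulVec w = 0 → ∃ c : K, w = c • v) {i : n} (hi : v i = 0) (j : n) :
    A.adjugate i j = 0 := by
  have hcol : A.mulVec (fun k => A.adjugate k j) = 0 := by
    funext k
    have h := congrFun (congrFun (Matrix.mul_adjugate A) k) j
    simp only [Matrix.mul_apply, hA, zero_smul, Matrix.zero_apply] at h
    simpa [Matrix.mulVec, dotProduct] using h
  obtain ⟨c, hc⟩ := hker _ hcol
  have := congrFun hc i
  simpa [hi] using this

/-! ## 4. Why it resists (status of the kill attempt, for the provers)

Exact reduction (numerically validated to 1e-6 in every kit job, `VALIDATE` line): for `D_RR`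
invertible, `ratio(U) := sup_W ‖adj D(refit W)_xy‖₁ / sup_W |det D(refit W)|
= sup_W ‖adj S(W)_xy‖₁ / sup_W |det S(W)|`, `S(W) = A(W_e) − B₁ 𝒱(W) G 𝒱(W)⁻¹ C₁` (24×24),
`𝒱(W) = ⊕_ports (V_π ⊗ 1_spin)` the per-port colour rotation by the outward star link, `B₁ =
−[P_π ⊗ 1]`, `C₁ = −[Q_π ⊗ 1]`, `P_{(μ,±)} = ½(1 ∓ γ_μ)`, `Q = 1 − P` (`QP = 0`: no backtracking),
`G = (D_RR⁻¹)|_{ports}`.  K1 ⟺ this 24×24 domination holds uniformly over the REALISABLE `G`.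
* Abstractly (arbitrary `G`) domination FAILS (§2; and the (C)-family: `Q_e Σ_xx P_e ≡ 0`,
  `Q_e Σ_xy ≡ 0`, `Σ_yx P_e ≡ 0`, `det S_yy ≡ 0` on `SU(3)^7` ⇒ `det S ≡ det S_xx · det S_yy ≡ 0`
  with kernel `(S_xx⁻¹ P_e (W_e − β) η, η)`, x-part rotating ⇒ `adj_xy ≢ 0`).
* Realisability is the whole question.  Each (C)-condition is an exact vanishing of spin-projected
  corners `P_π G(p_π, p_π′) Q_π′` of the exterior Green matrix; at lowest hopping order such a corner
  is ONE path term `a⁻³(−½ P⁻_ν P⁺_λ) ⊗ U U′ ≠ 0` — no structural zero, only fine-tuned cancellation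
  of infinitely many paths; codimension of the (C)-family ≈ 1.4·10⁴ real conditions against ≈ 6–8·10³
  effective exterior parameters within distance 3 of `X` on `4⁴`: NOT expected realisable by counting.
  The minimal codimension of the bad variety `𝒵 = {G : det S_G ≡ 0 on the fibre}` is unknown; a
  kernel vector with weight at `x` is invisible to at most ONE of x's ports (ranges of `½(1∓γ_ν)`
  for anticommuting `γ`'s meet in 0), which pushes codim 𝒵 to ≳ 10³.
* `m₀ ∈ (0, 2]`: `Re D ≥ m₀` ⇒ `Re G > 0`, `Re S(W) ≥ m₀`: no realisable `G` is anywhere near `𝒵`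
  (K1 true there with `C₀ = 144/m₀`, `W′ = W`).  `m₀ = 0`: `ker D(V) ≠ 0` iff `V` admits a
  covariantly constant section (`K_μ` unitaries, `‖Σ K_μ‖ = 4` forces `K_μ v = v ∀ μ`), destroyed by a
  generic refit: `sup_fibre |det| > 0` always.  The live range is `m₀ ∈ [−2, 0)`.
* γ₅-RECIPROCITY (new): `G† = Γ₅ G Γ₅` on the exterior gives
  `P_σ G(q,p) Q_π = γ₅ (P_π G(p,q) Q_σ)† γ₅` for any two ports — the projected corner that carries
  amplitude from x's port `p` to y's port `q` vanishes iff the reverse corner does.  Consequence: for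
  NON-adjacent `x, y` the triangular rotating-kernel mechanism (`Σ_yx ≡ 0`, `Σ_xy ≢ 0`, `det S_yy ≡ 0`)
  is impossible — one-way vanishing forces two-way vanishing, `S` block-diagonal, `adj_xy ≡ 0`.
  Rotating kernels of triangular type live on ADJACENT pairs only, where the direct hop
  `−P_e W_e / −Q_e W_e⁻¹` couples x and y outside `G` ((C2) ⟺ (C3) are then one condition).
* FIRST-ORDER INVISIBILITY (new, for provers; paper computation, conventions of the tree's
  `wilsonDirac`): let `φ` span `ker D(refit W₀)` (corank one; left kernel `Γ₅φ`).  Along a variation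
  `δV_π` of ONE port link (`V_π` = outward star link of port `π` of `x`, `P_π = ½(1∓γ_μ)`, `Q_π = 1−P_π`)
  the first-order change of the zero eigenvalue is `ψ†δDφ = tr(δV_π · [V_π⁻¹ R_π V_π⁻¹ − R_π†])`,
  `R_π := Σ_spin (P_π γ₅ φ(x))_s (P_π φ(p_π))_s†` (3×3 colour matrix pairing the γ₅-twisted outgoing
  amplitude at `x` with the returning amplitude at the port site).  Hence φ is first-order
  stationary under ALL variations of that link iff `R_π = V_π R_π† V_π` — NOT iff `R_π = 0`.  So
  "a zero mode with weight at x can always be lifted at first order by one of x's links" is FALSE as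
  a pointwise statement; the (C)-family sits inside `{R_π = 0 ∀π}`, the bad variety 𝒵 only needs the
  weaker intertwining identity at every fibre point, so 𝒵 may be larger (lower codimension) than the
  block-vanishing family — this is what the gradient numerics probe.
* NUMERICS, first returns (kit j013565, 2026-08-16): (i) free-background corank scan on `4⁴` = exactly §3
  (m₀ = −2 constant-parity classes: corank 12 ∀W, kernel weight 0 at x,y; mixed parity incl. adjacent:
  corank 0, smallest |λ| ≈ 1e-4; m₀ = 0: constants lifted, |λ| ≈ 0.02) — evidence file
  `evidence_corank_free_L4.md`; (ii) realisable tangent rank of `U ↦ G_PP` at a Haar exterior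
  (m₀ = −1): radius-1 links 728/728 real directions, radius-2 links 2240/2576 (the deficit = interior
  gauge directions); (iii) ABSTRACT search for `𝒵` — unconstrained `G ∈ M₁₆₈(ℂ)` (28k complex
  parameters), Adam on `log E_W|det S|² − log E_W‖adj S_xy‖²` with fresh Haar batches over the full
  15-link fibre, 8000 steps: NO fibre-wide degeneracy found (objective −1 → −3 nats only, smallest
  σ(S) stays 0.06–0.4, sup-based log(det/adj) = −2.3; γ₅-Hermitian `G`: objective → +1; non-adjacent
  pair: → −2), Jacobian of `W ↦ det S_G(W)` w.r.t. `G` of full rank 1500/1500 at the endpoints —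
  whereas the SAME optimiser on the single-link problem of §5 reaches `|det|` suppression 1e-10 in
  25 steps.  Reading: the fibre-wide bad variety with a rotating kernel is not cheaply reachable even
  WITHOUT the realisability constraint; the `∀` over 15 independent links is the obstruction, not the
  lattice.  A "k-link ladder" (kit j016398: free-link subsets of size 1,2,3,4,6,8,15) locates where
  reachability stops; six realisable adversarial gradient runs on `4⁴` and one on `6⁴` (j013566/67)
  are running.
-/

/-! ## 5. The single-link channel reduction (new; adjacent pair `y = x + μ̂`, link `e`)

Notation of §4; absorb the 14 port links into `Γ = G⁻¹` (port gauge) and put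
`𝒦₀ := a⁻¹ [Q_π P_π′ ⊗ 1₃]_{π ≠ π′, same star}` (intra-star bounce; `Q_π P_π = 0`),
`Γ′ := Γ − 𝒦₀`.  Since `A(W_e) = a(1 − N/a)` with `N² = 0` (`P_e Q_e = 0`), `A⁻¹ = a⁻¹(1 + N/a)` and
`C₁ A⁻¹ B₁ = 𝒦₀ + 𝒦₊(W_e) + 𝒦₋(W_e⁻¹)`, `𝒦₊ = a⁻² [Q_π P_e P_σ] ⊗ W_e` (x-port rows, y-port
columns), `𝒦₋ = a⁻² [Q_σ Q_e P_π] ⊗ W_e⁻¹`, both of rank ≤ 6 and factoring through the two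
2-dimensional link chiralities `range P_e`, `range Q_e`.  Hence, when `Γ′` is invertible,

  `det S(W_e) = a²⁴ (det Γ′ / det Γ) · det( 𝔚(W_e) − 𝔾 )`,  `𝔚(W) = diag(1₂ ⊗ W⁻¹, 1₂ ⊗ W)`,

with a CONSTANT 12×12 "link-channel Green matrix" `𝔾 = Vᵀ Γ′⁻¹ U` (blocks: `𝔾_XX` = y←x
cross propagation in the link channels, `𝔾_YY` = x←y, `𝔾_YX` / `𝔾_XY` = x-star / y-star returns).
(Consistency: along `W_e = diag(e^{iθ}, e^{−iθ}, 1)` this is a trigonometric polynomial of degree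
≤ 4 — `PauliBandLimit`.)  CONSEQUENCES.
* Physical reading (derived from `D = D⁰ + Δ_e`, `D⁰` := the refitted operator with the link `e`
  DELETED): `𝔾 = [[P_e G⁰(y,x) P_e, P_e G⁰(y,y) Q_e],[Q_e G⁰(x,x) P_e, Q_e G⁰(x,y) Q_e]]` — the two-site
  Green function of the LINK-LESS lattice in the link's chiral channels (`P_e = ½(1−γ_μ)`,
  `Q_e = ½(1+γ_μ)`), and `det D(refit W)/det D⁰ = det(𝔚(W_e) − 𝔾)·det(W_e)^0…` is the rank-12
  matrix-determinant lemma for adding one link.  (Formula certified numerically on random abstract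
  data to 1e-14: folder pycheck/check_sec5.py.)
* Branch I (`Γ′` generically invertible): `G ∈ 𝒵` forces `𝔾(𝒱) ∈ 𝔅 := {𝔾 ∈ M₁₂(ℂ) :
  det(𝔚(W) − 𝔾) = 0 ∀ W ∈ SU(3)}` for EVERY port-link setting `𝒱`.  FACTS (pure-python numerics in
  the seat folder, pycheck/frakB_*.py): (a) `𝔅 ≠ ∅` and is reached from a RANDOM start by plain
  gradient descent + Gauss–Newton at finite norm (`‖𝔾‖_F = 2.98`, `det 𝔾 = 0.043`,
  `|det(𝔚(W)−𝔾)| ≈ 1e-26` on 100 fresh Haar `W` against ≈ 1 for random `𝔾` of the same norm);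
  (b) an explicit linear family `𝔅_lin ⊂ 𝔅` (HALF-ROTATING kernel `v(W) = (α ⊗ W u, β ⊗ u)`):
  `𝔾_XX(α⊗1₃) = 0`, `𝔾_YX(α⊗1₃) = β⊗1₃`, `𝔾_XY(β⊗u) = α⊗u`, `𝔾_YY(β⊗u) = 0` (≈ 44 complex linear
  conditions, codim ≈ 41 in ℂ¹⁴⁴; verified `|det| ≈ 1e-16`); physically: the `P_e`-spinor `s_α`
  emitted at `x` does not reach `y`'s `P_e` channel through the link-less lattice, its
  chirality-flipping return at `x` is colour-trivial (`= s_β ⊗ 1`), and for one colour vector `u` the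
  `Q_e`-spinor `s_β ⊗ u` at `y` returns as `s_α ⊗ u` and does not reach `x`; (c) the numerically found
  point is NOT in `𝔅_lin` (its `u` depends on `W`): `𝔅` has further components; local tangent
  dimension there ≈ 45–50 of 144.  So the earlier guess "𝔅 = ∅" is FALSE and block-triangular
  exclusions say little: the single-link identity `det S(W_e) ≡ 0` is CHEAP (codim ≲ 100 of 144).
  What keeps `𝒵` expensive is only the quantifier over the other 14 links: `𝔾(𝒱) ∈ 𝔅` must hold
  for all `𝒱 ∈ SU(3)^14` (with `α, β, u` allowed to depend on `𝒱`), and e.g. the colour-trivial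
  return `Q_e G⁰(x,x) P_e s_α = s_β ⊗ 1` for ALL settings of x's seven port links is again a
  one-star fibre identity.  Net codimension of `𝒵`: unknown, plausibly 10³–10⁴ — of the same order
  as the realisable parameter count near `X`; the kit batch `k1-batch-abstract` (abstract-`G` Adam
  search + Jacobian-rank codimension estimate, and the realisable tangent rank `d G/d U`) measures
  both numbers.
* Branch II (`det Γ′(𝒱) ≡ 0` on the port fibre) ⟺ `det S⁰(𝒱) ≡ 0` for the LINK-LESS two-star
  Schur complement; the (C)-family of §4 lives here.
-/

/-! ## 6. Abstract rigidity is FALSE: explicit corank-one rotating points of the bad variety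

QUESTION (the exact-kill line): is there ANY port Green matrix `G` (realisable or not) with
`det S_G(W) = 0` for all `W ∈ SU(3)^15` and `adj S_G(W)_xy ≠ 0`?  Descent from random starts never
found one (§4 numerics), but the answer is YES, by the following mechanism (paper proof; numerically
certified in the seat folder `pycheck/explicit_Z_point.py` and kit j016536: corank exactly 1, next
singular values 0.02–0.07, kernel weights 0.13 at x / 0.99 at y, left kernel 0.33 / 0.94, hence
`adj_xy ≠ 0`, while the unperturbed skeleton has corank 3).
* SKELETON.  `G₀ := ⊕_π (g_π ⊗ 1₃)` port-diagonal and colour-scalar (`g_π ∈ M₄(ℂ)` spin matrices).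
  Then `[G₀, 𝒱(W)] = 0`, so `B(W) G₀ C(W) = B₁ G₀ C₁ =: T = diag(T_x ⊗ 1₃, T_y ⊗ 1₃)`,
  `T_z = Σ_{π ∈ ports(z)} P_π g_π Q_π`, and `S₀(W) = [[(a−T_x)⊗1, −P_e⊗W_e],[−Q_e⊗W_e⁻¹, (a−T_y)⊗1]]`,
  `det S₀ = det(a−T_x)³ · det(M_y)³`, `M_y := a − T_y − Q_e (a−T_x)⁻¹ P_e ∈ M₄(ℂ)` (the `W_e`'s cancel:
  `(Q_e⊗W⁻¹)((a−T_x)⁻¹⊗1)(P_e⊗W) = Q_e(a−T_x)⁻¹P_e ⊗ 1`).  Tune the `g_π` (one complex condition,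
  e.g. a common scale of y's spin matrices) so that `M_y` is singular with 1-dimensional kernel `κ`:
  corank `S₀ ≡ 3`, kernel `{(((a−T_x)⁻¹P_e κ) ⊗ W_e u, κ ⊗ u) : u ∈ ℂ³}` — every kernel vector is
  half-rotating, the colour triplet `u` is free (`adj ≡ 0`: harmless so far).
* COLOUR-RANK-TWO DRESSING.  Fix one x-port `π′` and a colour vector `k`; add
  `H := Σ_{π ∈ ports(x), π ≠ π′} (h_π ⊗ X_π)` in the blocks `(π, π′)` with `X_π k = 0` (rank 2).
  Then `B(W) H C(W) = Σ_π (P_π h_π Q_π′) ⊗ Y_π(W)`, `Y_π = V_π X_π V_π′⁻¹`, all `Y_π` killing the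
  ROTATING colour vector `u₀(W) := V_π′ k`.  Schur on the x-block `𝔛 = (a−T_x)⊗1 − Σ_π e_π ⊗ Y_π`
  (`e_π := P_π h_π Q_π′`): `𝔛⁻¹ = Σ_words (spin word) ⊗ (word in the Y_π)`, so the y-complement is
  `(1⊗W_e⁻¹)[M_y ⊗ 1 − Σ_{words ≠ ∅} m_word ⊗ Y_word](1⊗W_e)` and every `Y_word u₀ = 0`: the vector
  `κ ⊗ u₀(W)` is in its kernel for EVERY `W`.  Hence `det S_{G₀+H}(W) ≡ 0` on the whole fibre, and for
  `H ≠ 0` the other two members of the triplet are lifted: corank EXACTLY 1, kernel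
  `≈ (ξ(W), κ ⊗ V_π′k)` with `ξ ≠ 0` — a rotating, gauge-covariant kernel with weight on both
  centres.  So "det ≡ 0 on the two-star fibre ⇒ adj_xy ≡ 0" is FALSE for abstract `G`; any proof of
  K1 — even of its exact shadow `sup_fibre det = 0 ⇒ sup_fibre adj_xy = 0` — MUST use realisability.
* γ₅-HERMITIAN (realisable-CLASS) VERSION.  With `g_π := γ₅ h_π`, `h_π` Hermitian, `Γ₅ G₀` is Hermitian,
  `det M_y` is REAL along a real scale of y's `h`'s and changes sign (IVT root), and the one-column
  dressing is replaced by ONE inter-port pair `(ρ, π′) = h ⊗ p q†` together with its forced mirror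
  `(π′, ρ) = γ₅ h† γ₅ ⊗ q p†` (rank ONE, two-sided): every colour word then ends in `V_ρ p q† V_π′⁻¹` or
  `V_π′ q p† V_ρ⁻¹`, both killing the doubly-rotating vector `u(W) ∝ conj(V_π′ q × V_ρ p)`, so again
  `det S ≡ 0` with corank exactly 1 (certified: `pycheck/explicit_Z_point_g5.py`, kit j016616 —
  σ_min 0, next 0.007–0.03; kernel weights 0.17 / 0.985; left kernel = Γ₅ · right kernel, hence
  `adj_xy ≠ 0`).  So even the γ₅-Hermitian slice `𝒵_ℋ` has corank-one rotating points: the ONLY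
  remaining hypothesis a K1 proof can use is genuine lattice realisability of the port Green matrix.
* LOCAL SIZE OF 𝒵 (kit j016536): at the (non-Hermitian) `G*` the Jacobian `{d det S_G(W)/dG}_W`
  has row rank EXACTLY 3134 over ℂ (saturated: 2000/2000, 2918/3000, 3134/4000 = /5000 = /6000,
  eigenvalue #4000 = 2.6e-17): the Zariski tangent space of 𝒵 at `G*` has complex codimension 3134 in
  `ℂ^{28224}` (dimension 25090).  Z-WALK (kit j016580): displacing `G*` by 0.1·‖G*‖ along a generic
  vector of that tangent space raises the fresh-W median `σ_min/σ_ref` to 1.9e-4 (∝ t², vs ∝ t for a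
  random direction), and minimal-norm Gauss–Newton on 5000 fibre equations returns it to 1.7e-16 in
  FOUR steps (1.9e-4, 4.6e-5, 1.7e-6, 7.8e-10, 1.7e-16 — quadratic) at distance 0.0995: the corrected
  point is a generic (no longer colour-blind) point of 𝒵 with corank exactly 1 (next σ 0.1–0.26),
  kernel weights 0.737 / 0.676 (left 0.31–0.47 / 0.88–0.95).  So 𝒵 IS a smooth FAT complex manifold
  of codimension 3134 near `G*`.  γ₅-CLASS (kit j016616): on the real slice `ℋ = {Γ₅G Hermitian}`
  (28224 real dims; `det S` real there) the real Jacobian rank at the γ₅-Hermitian witness saturates at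
  EXACTLY 1587 (K = 2000 … 9000 rows): real codimension 1587.  Compare the REALISABLE tangent ranks of
  §4: 728 (radius-1 links), 2240 (radius 2, `4⁴`), 2696 (radius 2, `6⁴`) — ALREADY LARGER than 1587.
  Dimensionally, an exact realisable point of 𝒵 (⇒ `C(L) = ∞`, K1 false) is possible at `L = 4`
  with radius-2 exterior modifications; what remains is REACH (does the realisable family come close
  to 𝒵_ℋ?), now attacked directly by Levenberg–Marquardt in the link parameters on
  `det S_U(W_k) = 0`, `k ≤ 3000` (kit j016842/43) and by scale-free σ_min-descent (j016645/46/59).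
* WHAT REALISABILITY MUST THEN EXCLUDE (sharpened target for both sides): an exterior whose port
  Green matrix is, in the chirality corners the two stars use, (i) port-DIAGONAL (no propagation
  between distinct neighbours of x, resp. of y: `P_π G(p_π,p_π″) Q_π″ = 0`, π ≠ π″), (ii) colour-BLIND
  on the diagonal (`P_π G(p_π,p_π) Q_π = g_π ⊗ 1₃`), (iii) tuned (`det M_y = 0`), up to (iv) colour
  rank-deficient inter-port dressings with a covariant common kernel.  (i) is the exact vanishing of
  corners whose lowest hopping-order term is a single non-zero path (§4) — it has no perturbative
  realisation; whether the full variety `𝒵` near these points is fat enough to meet the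
  ≈2–3·10³-dimensional realisable families (§4 numerics D) is measured by the local codimension of
  `𝒵` at `G* = G₀ + H` (kit j016536 / j016539: Jacobian rank over 6000 / 16000 fibre points).
-/

/-! ## 7. Cycle-1 verdict (2026-08-16): no kill; why K1 resists, and the one remaining road to `C(L) = ∞`

* NOT load-bearing: the window `θ₀` / count `n_w` (§1); big or rigid kernels (§3); abstract linear
  algebra (§2, §6: domination fails for abstract and even for γ₅-Hermitian port Green matrices).
* LOAD-BEARING: lattice REALISABILITY of the port Green matrix, and only through REACH, not through
  dimension: the γ₅-slice of the bad variety has real codimension 1587, below the realisable tangent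
  ranks (2240 at radius 2 on `4⁴`; 2696 / 6768 at radius 2 / 3 on `6⁴`), but
  (a) generic exteriors (Haar, rough, smooth; `m₀ ∈ [−1.9, 0)`) give `S(W) ≈ a·1 − (small self-energy)`:
      `σ_min(S)/a ≈ 0.6–0.8` uniformly over the fibre — only the doubler edge `m₀ → −2` with roughness
      ≈ 0.5 brings the fibre median down to ≈ 0.14;
  (b) from such points, Levenberg–Marquardt in the 2576 radius-2 link parameters on 3000 fibre
      equations converges quadratically ONLY to the trivial escape (an exterior zero mode, `G → ∞`,
      `det D ≠ 0`) when the residual is scale-free, and merely creeps (0.136 → 0.056 in six wandering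
      steps) with the absolute residual `σ_min(S)/a`; even the ABSTRACT Gauss–Newton on the γ₅ slice
      started from these realisable `G(U)` creeps (0.135 → 0.063 in two steps at relative displacement
      0.18; from Haar `G(U)` the first step has relative size 3.9): realisable port Green matrices lie
      OUTSIDE the quadratic basin of `𝒵`, whose width in `σ_min/a` is ≲ 1e-3 (Z-walk);
  (c) all direct measurements of the crux ratio on `4⁴`/`6⁴` (annealing, analytic-gradient descent,
      Haar/rough/smooth, m₀ from −0.5 to −1.9) sit at `sup‖adj_xy‖₁ / sup|det| ≈ 2.5` and do not move.
* So the cheapest remaining falsifier is GLOBAL, not local: drive a realisable `G(U)` into the basin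
  (fibre-median `σ_min(S)/a ≲ 1e-3` WITHOUT `‖G‖ → ∞`) — e.g. exteriors with several tuned
  dislocation modes adjacent to both stars at `m₀ ≈ −1.9…−2`, larger radius / volume (`6⁴`, r = 3,
  P = 8112) — and then the realisable LM of kit/batch/newton4.py snaps on (or provably cannot:
  a certified lower bound on `σ_min(S_U(W))/a` over realisable `U` would be the positive lemma the
  provers need, a "two-star passivity at negative mass").
-/

/-- Kronecker product acting on a product vector: `(A ⊗ B)(κ ⊗ u) = (Aκ) ⊗ (Bu)`. [folklore] -/
theorem kronecker_mulVec_prod {m c : Type*} [Fintype m] [Fintype c]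
    (A : Matrix m m ℂ) (B : Matrix c c ℂ) (κ : m → ℂ) (u : c → ℂ) :
    (A ⊗ₖ B) *ᵥ (fun p : m × c => κ p.1 * u p.2) = fun p => (A *ᵥ κ) p.1 * (B *ᵥ u) p.2 := by
  funext p
  simp only [Matrix.mulVec, dotProduct, Matrix.kroneckerMap_apply, Fintype.sum_prod_type,
    Finset.sum_mul_sum]
  refine Finset.sum_congr rfl fun j _ => Finset.sum_congr rfl fun l _ => ?_
  ring

/-- **The dressing mechanism of §6, abstractly (checked).**  If the tuned skeleton matrix `M`
(`= M_y`) kills the spinor `κ` and EVERY colour word `Y i` (products of the dressed inter-port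
blocks `V_ρ X V_σ⁻¹`) kills the same colour vector `u` (`= u₀(W)`), then `κ ⊗ u` lies in the kernel
of the dressed y-complement `M ⊗ 1 − Σ_i m_i ⊗ Y_i` for ARBITRARY spin coefficients `m_i` — hence
`det S(W) = 0` at every fibre point `W`, which is the exact-degeneracy half of the §6 witnesses
(the corank-one half is the numerical certificate). [folklore] -/
theorem kron_dressing_kernel {m c ι : Type*} [Fintype m] [Fintype c] [Fintype ι]
    [DecidableEq c] (M : Matrix m m ℂ) (ms : ι → Matrix m m ℂ) (Y : ι → Matrix c c ℂ)
    (κ : m → ℂ) (u : c → ℂ) (hκ : M *ᵥ κ = 0) (hu : ∀ i, Y i *ᵥ u = 0) :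
    (M ⊗ₖ (1 : Matrix c c ℂ) - ∑ i, ms i ⊗ₖ Y i) *ᵥ (fun p : m × c => κ p.1 * u p.2) = 0 := by
  rw [Matrix.sub_mulVec, Matrix.sum_mulVec, kronecker_mulVec_prod, hκ]
  have h2 : ∀ i, (ms i ⊗ₖ Y i) *ᵥ (fun p : m × c => κ p.1 * u p.2) = 0 := by
    intro i
    rw [kronecker_mulVec_prod, hu i]
    funext p
    simp
  simp only [h2, Finset.sum_const_zero, sub_zero]
  funext p
  simp

/-- … and therefore the dressed y-complement is singular whenever `κ ≠ 0`, `u ≠ 0`. [folklore] -/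
theorem det_kron_dressing_eq_zero {m c ι : Type*} [Fintype m] [Fintype c] [Fintype ι]
    [DecidableEq m] [DecidableEq c] (M : Matrix m m ℂ) (ms : ι → Matrix m m ℂ)
    (Y : ι → Matrix c c ℂ) (κ : m → ℂ) (u : c → ℂ) (hκ : M *ᵥ κ = 0) (hu : ∀ i, Y i *ᵥ u = 0)
    (hκ0 : κ ≠ 0) (hu0 : u ≠ 0) :
    (M ⊗ₖ (1 : Matrix c c ℂ) - ∑ i, ms i ⊗ₖ Y i).det = 0 := by
  refine Matrix.exists_mulVec_eq_zero_iff.mp ⟨fun p : m × c => κ p.1 * u p.2, ?_,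
    kron_dressing_kernel M ms Y κ u hκ hu⟩
  obtain ⟨j, hj⟩ := Function.ne_iff.mp hκ0
  obtain ⟨l, hl⟩ := Function.ne_iff.mp hu0
  intro h
  have := congrFun h (j, l)
  simp only [Pi.zero_apply, mul_eq_zero] at this
  rcases this with h1 | h1
  · exact hj h1
  · exact hl h1

end Summit.QuantumFields.QCD.Cruxes.FibreCofactorDomination.Disproof
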